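import Literature.AlgebraicGeometry.Resolution.DualDerivationsPrimeField
import Literature.AlgebraicGeometry.Resolution.ConormalSplitFormallySmooth
import Literature.AlgebraicGeometry.Resolution.KummerNormalForm
import Literature.FieldTheory.Separability.PIndependentDerivations
import Literature.RingTheory.Smooth.FieldCharP
import HarnessLib

/-!
# Regular type ⟺ a (logarithmic) derivation with unit value — over an ARBITRARY ground field

Route `ResolutionOfSingularities/RadicialJung`, crux `CleanModels` (stmt-ResolutionOfSingularities-15917),
the research stub of the registered line `via-clean-models` of crux `DescentPerfectToAll`
(stmt-ResolutionOfSingularities-0549). Helper file (`--supports`), OURS; nothing here is a statement of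
Hironaka's manuscript.

The crux `CleanModels` asks, at a point `v` of a regular model, for a representative `u₀` of REGULAR
TYPE: `u₀` a unit with `u₀ - c^p ∉ 𝔪_v` for every `c` (wound) or `u₀ - c^p ∈ 𝔪_v ∖ 𝔪_v²` for some
`c` (transversal); with boundary equations `x₁, …, x_r` this is the tree's
`IsWoundOrTransversalAt p x u` (`KummerNormalForm.lean`). Giraud's surface theorem (Bull. SMF 111
(1983), Prop. 1.5 (ii) (c-2) and the remark after its proof, p. 114: "df ne s'annule pas au point ξ
si, et seulement si, on a (c-2) avec r = 0") phrases the same condition through DIFFERENTIALS: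
`(x₁, …, x_r, u)` differentially free. The tree had the implication «a logarithmic derivation `D`
(`x_j ∣ D x_j`) with `D u` a unit ⇒ wound-or-transversal» (`isWoundOrTransversalAt_of_derivation`,
elementary). This file proves the CONVERSE, for local rings formally smooth over the prime field
`𝔽_p` — e.g. every regular local ring essentially of finite type over ANY field of characteristic
`p` (`formallySmooth_zmod_of_isRegularLocalRing_of_essFiniteType`), `F`-finite or not — so that on
the stalks of the crux's models the derivation-free "regular type" and Giraud's differential
condition are EQUIVALENT, with no hypothesis on the ground field or on the residue field:

* `exists_derivation_isUnit_of_forall_sub_pow_not_mem_sq` — if `f - g^p ∉ 𝔪²` for every `g`, some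
  derivation `D ∈ Der(O)` has `D f` a unit; `exists_derivation_isUnit_iff_forall_sub_pow_not_mem_sq`
  and `forall_derivation_apply_mem_iff_exists_sub_pow_mem_sq` (Giraud's `E(f)`, Déf. 1.2, read
  without `Ω¹`: «every derivation of `O` sends `f` into `𝔪`» ⟺ `f ∈ O^p + 𝔪²`);
* `exists_logDerivation_isUnit_of_isWoundOrTransversalAt` — for `x : Fin r → 𝔪` with independent
  images in `𝔪/𝔪²` and `u` wound-or-transversal along `x`, a derivation `D` with `D x_j = 0` for all
  `j` and `D u` a unit; `isWoundOrTransversalAt_iff_exists_logDerivation` (the equivalence);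
* the specialisations to REGULAR local rings essentially of finite type over a field (and to
  sub-families of a regular system of parameters) are in the companion file
  `RadicialJungCleanModelsRegularTypeDerivationsRegular.lean`.

Mechanism (Matsumura Thm. 25.2 / Stacks 031I, all inputs PROVED in the tree): the residue field `κ`
is formally smooth over `𝔽_p` (`formallySmooth_of_charP`), so `𝔪/𝔪² → κ ⊗ Ω_{O/𝔽_p}` is injective
(`one_tmul_D_eq_zero_iff_mem_sq`); a residue class outside `κ^p` is detected by a derivation of `κ`
(`exists_derivation_eq_one_eqOn_zero`); either way one gets an `O`-linear `Φ : Ω_{O/𝔽_p} → κ` with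
`Φ(df) ≠ 0` (and `Φ(d𝔪) = 0` in the wound case), which lifts to `Ω_{O/𝔽_p} → O` because
`Ω_{O/𝔽_p}` is projective (formal smoothness); the logarithmic correction along `x` uses the dual
derivations `∂_j x_i = δ_ij` (`exists_dual_derivations_int`).

## References
* J. Giraud, *Forme normale d'une fonction sur une surface de caractéristique positive*, Bull. Soc.
  Math. France 111 (1983) 109–124: 1.1, Prop. 1.5, p. 114. [Giraud1983]
* H. Matsumura, *Commutative Ring Theory* (1986), Thm. 25.2, Thm. 26.9, Thm. 30.6. [Matsumura1987]
-/

noncomputable section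

set_option linter.dupNamespace false -- mandated namespace of this single-conjunct summit

open IsLocalRing Module TensorProduct KaehlerDifferential
open Literature.AlgebraicGeometry.Resolution Literature.FieldTheory.Separability

namespace Summit.ResolutionOfSingularities.ResolutionOfSingularities.Theorems.RadicialJung.CleanModels

universe u v

/-! ## Generalities on derivations in characteristic `p` -/

/-- A `ℤ`-derivation of an `𝔽_p`-algebra into an `𝔽_p`-module is (the restriction of scalars of) an
`𝔽_p`-derivation: `𝔽_p`-linearity is automatic since every scalar is an integer multiple of `1`.
[folklore] -/
theorem exists_derivation_zmod_of_int (p : ℕ) {A M : Type*} [CommRing A] [AddCommGroup M]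
    [Algebra (ZMod p) A] [Module A M] [Module (ZMod p) M]
    (δ : Derivation ℤ A M) : ∃ δ' : Derivation (ZMod p) A M, ∀ a, δ' a = δ a := by
  let L : A →ₗ[ZMod p] M :=
    { toFun := δ
      map_add' := map_add δ
      map_smul' := fun c a => by
        obtain ⟨n, rfl⟩ := ZMod.intCast_surjective c
        rw [RingHom.id_apply, Int.cast_smul_eq_zsmul, Int.cast_smul_eq_zsmul, map_zsmul] }
  exact ⟨⟨L, δ.map_one_eq_zero, fun a b => δ.leibniz a b⟩, fun a => rfl⟩

/-- In characteristic `p` a derivation kills `p`-th powers (`D(c^p) = p c^{p-1} Dc = 0`).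
[cite: Matsumura1987, §25] -/
theorem derivation_apply_pow_char_eq_zero (p : ℕ) {R O M : Type*} [CommSemiring R] [CommRing O]
    [Algebra R O] [AddCommGroup M] [Module O M] [Module R M] (D : Derivation R O M) [CharP O p]
    (c : O) : D (c ^ p) = 0 := by
  rw [D.leibniz_pow, ← Nat.cast_smul_eq_nsmul O, CharP.cast_eq_zero O p, zero_smul]

/-- EASY HALF (any local ring of characteristic `p`): if `D f` is a unit for some derivation `D`,
then `f - g^p ∉ 𝔪²` for every `g` — derivations kill `p`-th powers and map `𝔪²` into `𝔪`
(Leibniz). [cite: Giraud1983, Prop. 1.5 (remark p. 114)] -/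
theorem forall_sub_pow_not_mem_sq_of_isUnit_derivation_apply (p : ℕ) {O : Type*} [CommRing O]
    [IsLocalRing O] [CharP O p] {f : O} (D : Derivation ℤ O O) (hD : IsUnit (D f)) (g : O) :
    f - g ^ p ∉ maximalIdeal O ^ 2 := by
  intro hmem
  have h1 : D (f - g ^ p) ∈ maximalIdeal O := derivation_apply_mem_maximalIdeal_of_mem_sq D hmem
  rw [map_sub, derivation_apply_pow_char_eq_zero p D g, sub_zero] at h1
  exact (mem_maximalIdeal _).mp h1 hD

/-- Membership form of "`h̄ ∉ span(x̄ⱼ)` in `𝔪/𝔪²`": if `h ∉ 𝔪² + (x_j : j)` then the image of `h` in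
the cotangent space is outside the span of the images of the `x_j`. [folklore] -/
theorem toCotangent_not_mem_span_of_not_mem_sup {O : Type*} [CommRing O] [IsLocalRing O]
    {r : ℕ} {x : Fin r → O} (hx : ∀ j, x j ∈ maximalIdeal O) {h : O} (hh : h ∈ maximalIdeal O)
    (hnot : h ∉ maximalIdeal O ^ 2 ⊔ Ideal.span (Set.range x)) :
    (maximalIdeal O).toCotangent ⟨h, hh⟩ ∉
      Submodule.span (ResidueField O)
        (Set.range fun j => (maximalIdeal O).toCotangent ⟨x j, hx j⟩) := by
  classical
  intro hmem
  apply hnot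
  -- write the membership with coefficients in `κ`, lift them to `O`
  obtain ⟨c, hc⟩ := (Submodule.mem_span_range_iff_exists_fun (ResidueField O)).mp hmem
  choose a ha using fun j => Ideal.Quotient.mk_surjective (c j)
  have key : (maximalIdeal O).toCotangent (∑ j, a j • (⟨x j, hx j⟩ : maximalIdeal O)) =
      ∑ j, c j • (maximalIdeal O).toCotangent ⟨x j, hx j⟩ := by
    rw [map_sum]
    refine Finset.sum_congr rfl fun j _ => ?_
    rw [LinearMap.map_smul_of_tower, ← ha j]
    rfl
  have hsum : (maximalIdeal O).toCotangent
      (⟨h, hh⟩ - ∑ j, a j • (⟨x j, hx j⟩ : maximalIdeal O)) = 0 := by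
    rw [map_sub, key, hc, sub_self]
  rw [Ideal.toCotangent_eq_zero] at hsum
  have hcoe : ((⟨h, hh⟩ - ∑ j, a j • (⟨x j, hx j⟩ : maximalIdeal O) : maximalIdeal O) : O) =
      h - ∑ j, a j * x j := by
    simp [smul_eq_mul]
  rw [hcoe] at hsum
  have hspan : ∑ j, a j * x j ∈ Ideal.span (Set.range x) :=
    Ideal.sum_mem _ fun j _ => Ideal.mul_mem_left _ _ (Ideal.subset_span ⟨j, rfl⟩)
  have := Submodule.add_mem_sup hsum hspan
  rwa [sub_add_cancel] at this

/-! ## The boundary-free criterion: `f ∉ O^p + 𝔪²` ⟺ some derivation does not vanish on `f` -/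

section Core

variable (p : ℕ) [Fact p.Prime] {O : Type u} [CommRing O] [IsLocalRing O] [Algebra (ZMod p) O]

/-- The key functional: for `O` local with `Algebra (ZMod p) O` and `f` with `f - g^p ∉ 𝔪²` for all
`g`, there is an `O`-linear `Φ : Ω_{O/𝔽_p} → κ` with `Φ(df) ≠ 0` which moreover vanishes on `d𝔪`
whenever `f` is WOUND (`f - g^p ∉ 𝔪` for all `g`). Two cases: if `f ≡ c^p (mod 𝔪)` then
`h = f - c^p ∈ 𝔪 ∖ 𝔪²` has `1 ⊗ dh ≠ 0` by the injectivity of the conormal map (residue field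
formally smooth over `𝔽_p`), and a `κ`-linear functional separates it; otherwise the residue of `f`
lies outside `κ^p` and a derivation `δ` of `κ` with `δ(f̄) = 1` composed with `O → κ` factors through
`Ω_{O/𝔽_p}`. [cite: Matsumura1987, Thm. 25.2] -/
theorem exists_linearMap_kaehler_apply_ne_zero {f : O}
    (hf : ∀ g : O, f - g ^ p ∉ maximalIdeal O ^ 2) :
    ∃ Φ : Ω[O⁄ZMod p] →ₗ[O] ResidueField O, Φ (D (ZMod p) O f) ≠ 0 ∧
      ((∀ g : O, f - g ^ p ∉ maximalIdeal O) → ∀ y ∈ maximalIdeal O, Φ (D (ZMod p) O y) = 0) := by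
  classical
  haveI : CharP O p := charP_of_injective_algebraMap (algebraMap (ZMod p) O).injective p
  let κ := ResidueField O
  haveI : CharP κ p := charP_of_injective_algebraMap (algebraMap (ZMod p) κ).injective p
  by_cases hc : ∃ c : O, f - c ^ p ∈ maximalIdeal O
  · -- transversal case: `h = f - c^p ∈ 𝔪 ∖ 𝔪²`
    obtain ⟨c, hc⟩ := hc
    haveI h𝕜 : Algebra.FormallySmooth (ZMod p) κ :=
      Literature.RingTheory.Smooth.formallySmooth_of_charP p κ
    have hne : (1 : κ) ⊗ₜ[O] (D (ZMod p) O (f - c ^ p)) ≠ 0 := fun h0 =>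
      hf c ((one_tmul_D_eq_zero_iff_mem_sq (R := ZMod p) hc).mp h0)
    obtain ⟨lam, hlam⟩ := Module.Projective.exists_dual_ne_zero κ hne
    refine ⟨lam.restrictScalars O ∘ₗ TensorProduct.mk O κ (Ω[O⁄ZMod p]) 1, ?_, fun hw => ?_⟩
    · have hD : D (ZMod p) O f = D (ZMod p) O (f - c ^ p) := by
        rw [map_sub, derivation_apply_pow_char_eq_zero p (D (ZMod p) O) c, sub_zero]
      rw [hD]
      exact hlam
    · exact absurd hc (hw c)
  · -- wound case: the residue of `f` is not a `p`-th power
    push Not at hc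
    let F : Subfield κ := (frobenius κ p).fieldRange
    have hF : ∀ y : κ, y ^ p ∈ F := fun y => ⟨y, rfl⟩
    have hb : residue O f ∉ F := by
      rintro ⟨y, hy⟩
      obtain ⟨c, rfl⟩ := residue_surjective y
      apply hc c
      rw [← residue_eq_zero_iff, map_sub, map_pow]
      exact sub_eq_zero.mpr hy.symm
    obtain ⟨δ, hδ1, -⟩ := exists_derivation_eq_one_eqOn_zero p F hF hb
    -- `δ ∘ residue : O → κ`, as an `𝔽_p`-derivation, factors through `Ω_{O/𝔽_p}`
    obtain ⟨e, he⟩ := exists_derivation_zmod_of_int p (δ.compAlgebraMap O)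
    refine ⟨e.liftKaehlerDifferential, ?_, fun _ y hy => ?_⟩
    · rw [Derivation.liftKaehlerDifferential_comp_D, he, Derivation.compAlgebraMap_apply]
      change δ (residue O f) ≠ 0
      rw [hδ1]
      exact one_ne_zero
    · rw [Derivation.liftKaehlerDifferential_comp_D, he, Derivation.compAlgebraMap_apply]
      change δ (residue O y) = 0
      rw [(residue_eq_zero_iff y).mpr hy, map_zero]

variable [Algebra.FormallySmooth (ZMod p) O]

/-- **`f - g^p ∉ 𝔪²` for all `g` ⇒ some derivation has `D f` a unit**, for `O` local and formally
smooth over `𝔽_p` (e.g. regular local essentially of finite type over any field of characteristic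
`p`): the functional `Φ : Ω_{O/𝔽_p} → κ` of `exists_linearMap_kaehler_apply_ne_zero` lifts along
`O → κ` since `Ω_{O/𝔽_p}` is projective, and `D = Φ̃ ∘ d`.
[cite: Giraud1983, Prop. 1.5 (remark p. 114)] [cite: Matsumura1987, Thm. 25.2, Thm. 30.6] -/
theorem exists_derivation_isUnit_of_forall_sub_pow_not_mem_sq {f : O}
    (hf : ∀ g : O, f - g ^ p ∉ maximalIdeal O ^ 2) :
    ∃ D : Derivation ℤ O O, IsUnit (D f) := by
  obtain ⟨Φ, hΦ, -⟩ := exists_linearMap_kaehler_apply_ne_zero p hf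
  have hsurj : Function.Surjective (Algebra.linearMap O (ResidueField O)) := residue_surjective
  obtain ⟨ψ, hψ⟩ :=
    Module.projective_lifting_property (Algebra.linearMap O (ResidueField O)) Φ hsurj
  have hres : residue O (ψ (D (ZMod p) O f)) = Φ (D (ZMod p) O f) := by
    have := LinearMap.congr_fun hψ (D (ZMod p) O f)
    rw [LinearMap.comp_apply] at this
    exact this
  refine ⟨(ψ.compDer (D (ZMod p) O)).restrictScalars ℤ, ?_⟩
  change IsUnit (ψ (D (ZMod p) O f))
  by_contra hnu
  have hmem : ψ (D (ZMod p) O f) ∈ maximalIdeal O := by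
    rwa [mem_maximalIdeal, mem_nonunits_iff]
  exact hΦ (hres ▸ (residue_eq_zero_iff _).mpr hmem)

/-- **The boundary-free criterion.** For `O` local, formally smooth over `𝔽_p`:
`(∃ D ∈ Der(O), D f ∈ O^×) ⟺ ∀ g, f - g^p ∉ 𝔪²` — Giraud's "`df` does not vanish at the point"
read without `Ω¹`. [cite: Giraud1983, Prop. 1.5 (remark p. 114)] -/
theorem exists_derivation_isUnit_iff_forall_sub_pow_not_mem_sq (f : O) :
    (∃ D : Derivation ℤ O O, IsUnit (D f)) ↔ ∀ g : O, f - g ^ p ∉ maximalIdeal O ^ 2 := by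
  haveI : CharP O p := charP_of_injective_algebraMap (algebraMap (ZMod p) O).injective p
  exact ⟨fun ⟨D, hD⟩ g => forall_sub_pow_not_mem_sq_of_isUnit_derivation_apply p D hD g,
    exists_derivation_isUnit_of_forall_sub_pow_not_mem_sq p⟩

/-- **Giraud's `E(f)` without `Ω¹`** (Déf. 1.2: the points where `df ∈ 𝔪 Ω¹`): for `O` local and
formally smooth over `𝔽_p`, every derivation of `O` maps `f` into `𝔪` iff `f ∈ O^p + 𝔪²`.
[cite: Giraud1983, Déf. 1.2, Prop. 1.5] -/
theorem forall_derivation_apply_mem_iff_exists_sub_pow_mem_sq (f : O) :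
    (∀ D : Derivation ℤ O O, D f ∈ maximalIdeal O) ↔ ∃ g : O, f - g ^ p ∈ maximalIdeal O ^ 2 := by
  haveI : CharP O p := charP_of_injective_algebraMap (algebraMap (ZMod p) O).injective p
  constructor
  · intro h
    by_contra hne
    push Not at hne
    obtain ⟨D, hD⟩ := exists_derivation_isUnit_of_forall_sub_pow_not_mem_sq p hne
    exact (mem_maximalIdeal _).mp (h D) hD
  · rintro ⟨g, hg⟩ D
    by_contra hD
    rw [mem_maximalIdeal, mem_nonunits_iff, not_not] at hD
    exact forall_sub_pow_not_mem_sq_of_isUnit_derivation_apply p D hD g hg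

/-! ## The boundary version: wound-or-transversal ⟺ a logarithmic derivation with unit value -/

/-- **Wound-or-transversal ⇒ a logarithmic derivation with unit value.** For `O` local and formally
smooth over `𝔽_p`, `x : Fin r → 𝔪` with linearly independent images in `𝔪/𝔪²`, and `u`
wound-or-transversal along `x` (`IsWoundOrTransversalAt p x u`), there is `D ∈ Der(O)` with
`D x_j = 0` for all `j` and `D u ∈ O^×`. Transversal case (`h = u - c^p ∈ 𝔪 ∖ (𝔪² + (x))`):
`(h, x₁, …, x_r)` is independent in `𝔪/𝔪²`, take the dual derivation `∂_h`. Wound case: lift the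
functional of `exists_linearMap_kaehler_apply_ne_zero` (which kills `d𝔪`) to `D₀` and correct it
along `x` by the dual derivations, `D = D₀ - Σ_j D₀(x_j) ∂_j` (`D₀(x_j) ∈ 𝔪`).
[cite: Giraud1983, Prop. 1.5 (ii) (c-2)] [cite: Matsumura1987, Thm. 30.6 (ii)] -/
theorem exists_logDerivation_isUnit_of_isWoundOrTransversalAt {r : ℕ} {x : Fin r → O}
    (hx : ∀ j, x j ∈ maximalIdeal O)
    (hli : LinearIndependent (ResidueField O) fun j => (maximalIdeal O).toCotangent ⟨x j, hx j⟩)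
    {u : O} (hu : IsWoundOrTransversalAt p x u) :
    ∃ D : Derivation ℤ O O, (∀ j, D (x j) = 0) ∧ IsUnit (D u) := by
  classical
  haveI : CharP O p := charP_of_injective_algebraMap (algebraMap (ZMod p) O).injective p
  rcases hu with hw | ⟨c, hc, hnot⟩
  · -- wound case
    have hf : ∀ g : O, u - g ^ p ∉ maximalIdeal O ^ 2 := fun g hg =>
      hw g (Ideal.pow_le_self two_ne_zero hg)
    obtain ⟨Φ, hΦ, hΦ0⟩ := exists_linearMap_kaehler_apply_ne_zero p hf
    have hsurj : Function.Surjective (Algebra.linearMap O (ResidueField O)) := residue_surjective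
    obtain ⟨ψ, hψ⟩ :=
      Module.projective_lifting_property (Algebra.linearMap O (ResidueField O)) Φ hsurj
    have hψres : ∀ y, residue O (ψ (D (ZMod p) O y)) = Φ (D (ZMod p) O y) := fun y => by
      have := LinearMap.congr_fun hψ (D (ZMod p) O y)
      rw [LinearMap.comp_apply] at this
      exact this
    let D₀ : Derivation ℤ O O := (ψ.compDer (D (ZMod p) O)).restrictScalars ℤ
    have hD₀ : ∀ y, D₀ y = ψ (D (ZMod p) O y) := fun y => rfl
    have hD₀x : ∀ j, D₀ (x j) ∈ maximalIdeal O := fun j => by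
      rw [← residue_eq_zero_iff, hD₀, hψres]
      exact hΦ0 hw (x j) (hx j)
    obtain ⟨δ, hδ⟩ := exists_dual_derivations_int p x hx hli
    refine ⟨D₀ - ∑ j, D₀ (x j) • δ j, fun i => ?_, ?_⟩
    · rw [Derivation.sub_apply, derivation_sum_apply]
      simp only [Derivation.smul_apply, smul_eq_mul, hδ, mul_ite, mul_one, mul_zero,
        Finset.sum_ite_eq', Finset.mem_univ, if_true, sub_self]
    · rw [Derivation.sub_apply, derivation_sum_apply]
      simp only [Derivation.smul_apply, smul_eq_mul]
      by_contra hnu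
      have hmem : D₀ u - ∑ j, D₀ (x j) * δ j u ∈ maximalIdeal O := by
        rwa [mem_maximalIdeal, mem_nonunits_iff]
      have hs : ∑ j, D₀ (x j) * δ j u ∈ maximalIdeal O :=
        Ideal.sum_mem _ fun j _ => Ideal.mul_mem_right _ _ (hD₀x j)
      have hu0 : D₀ u ∈ maximalIdeal O := by
        have := Ideal.add_mem _ hmem hs
        rwa [sub_add_cancel] at this
      rw [← residue_eq_zero_iff, hD₀, hψres] at hu0
      exact hΦ hu0
  · -- transversal case: `h = u - c^p`, the family `(h, x)` is independent in `𝔪/𝔪²`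
    set h := u - c ^ p with hh
    let y : Option (Fin r) → O := fun o => Option.casesOn' o h x
    have hy : ∀ o, y o ∈ maximalIdeal O := by
      rintro (_ | j)
      exacts [hc, hx j]
    have hli' : LinearIndependent (ResidueField O)
        fun o => (maximalIdeal O).toCotangent ⟨y o, hy o⟩ := by
      have heq : (fun o => (maximalIdeal O).toCotangent ⟨y o, hy o⟩) = fun o =>
          Option.casesOn' o ((maximalIdeal O).toCotangent ⟨h, hc⟩)
            (fun j => (maximalIdeal O).toCotangent ⟨x j, hx j⟩) := by
        funext o
        cases o <;> rfl
      rw [heq]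
      exact hli.option (toCotangent_not_mem_span_of_not_mem_sup hx hc hnot)
    obtain ⟨δ, hδ⟩ := exists_dual_derivations_int p y hy hli'
    refine ⟨δ none, fun j => ?_, ?_⟩
    · have := hδ none (some j)
      rw [if_neg (Option.some_ne_none j).symm] at this
      exact this
    · have h0 : δ none h = 1 := by
        have := hδ none none
        rwa [if_pos rfl] at this
      have : δ none u = 1 := by
        have hu' : u = h + c ^ p := by rw [hh, sub_add_cancel]
        rw [hu', map_add, derivation_apply_pow_char_eq_zero p (δ none) c, add_zero, h0]
      rw [this]
      exact isUnit_one

/-- **Wound-or-transversal ⟺ a logarithmic derivation with unit value** (`O` local, formally smooth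
over `𝔽_p`; `x` independent in `𝔪/𝔪²`): Giraud's differential condition "(x, u) differentially
free" (Prop. 1.5 (ii) (c-2)) coincides with the derivation-free `IsWoundOrTransversalAt p x u`.
The implication ⇐ is the tree's `isWoundOrTransversalAt_of_derivation`.
[cite: Giraud1983, Prop. 1.5 (ii)] -/
theorem isWoundOrTransversalAt_iff_exists_logDerivation {r : ℕ} {x : Fin r → O}
    (hx : ∀ j, x j ∈ maximalIdeal O)
    (hli : LinearIndependent (ResidueField O) fun j => (maximalIdeal O).toCotangent ⟨x j, hx j⟩)
    (u : O) :
    IsWoundOrTransversalAt p x u ↔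
      ∃ D : Derivation ℤ O O, (∀ j, x j ∣ D (x j)) ∧ IsUnit (D u) := by
  haveI : CharP O p := charP_of_injective_algebraMap (algebraMap (ZMod p) O).injective p
  constructor
  · intro hu
    obtain ⟨D, hDx, hDu⟩ := exists_logDerivation_isUnit_of_isWoundOrTransversalAt p hx hli hu
    exact ⟨D, fun j => ⟨0, by rw [hDx j, mul_zero]⟩, hDu⟩
  · rintro ⟨D, hlog, hDu⟩
    exact isWoundOrTransversalAt_of_derivation p x hx u D hlog hDu

/-- Boundary-free corollary in the crux's own words: for an element `u` of a local ring formally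
smooth over `𝔽_p`, «`u - c^p ∉ 𝔪` for all `c`, or `u - c^p ∈ 𝔪 ∖ 𝔪²` for some `c`» (the regular
type of `RadicialJung.CleanModels`) iff some derivation has `D u` a unit.
[cite: Giraud1983, Prop. 1.5] -/
theorem regularType_iff_exists_derivation_isUnit (u : O) :
    ((∀ c : O, u - c ^ p ∉ maximalIdeal O) ∨
      (∃ c : O, u - c ^ p ∈ maximalIdeal O ∧ u - c ^ p ∉ maximalIdeal O ^ 2)) ↔
      ∃ D : Derivation ℤ O O, IsUnit (D u) := by
  have hli : LinearIndependent (ResidueField O)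
      fun j : Fin 0 => (maximalIdeal O).toCotangent ⟨(Fin.elim0 j : O), j.elim0⟩ :=
    linearIndependent_empty_type
  have h := isWoundOrTransversalAt_iff_exists_logDerivation p (x := (Fin.elim0 : Fin 0 → O))
    (fun j => j.elim0) hli u
  have hspan : Ideal.span (Set.range (Fin.elim0 : Fin 0 → O)) = ⊥ := by
    rw [Set.range_eq_empty, Ideal.span_empty]
  constructor
  · intro hu
    have hw : IsWoundOrTransversalAt p (Fin.elim0 : Fin 0 → O) u := by
      rcases hu with hw | ⟨c, hc1, hc2⟩
      · exact Or.inl hw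
      · exact Or.inr ⟨c, hc1, by rwa [hspan, sup_bot_eq]⟩
    obtain ⟨D, -, hD⟩ := h.mp hw
    exact ⟨D, hD⟩
  · rintro ⟨D, hD⟩
    rcases h.mpr ⟨D, fun j => j.elim0, hD⟩ with hw | ⟨c, hc1, hc2⟩
    · exact Or.inl hw
    · rw [hspan, sup_bot_eq] at hc2
      exact Or.inr ⟨c, hc1, hc2⟩

end Core

end Summit.ResolutionOfSingularities.ResolutionOfSingularities.Theorems.RadicialJung.CleanModels

end
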